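/-
Copyright (c) 2026 the pub-hodgecm-mathlib formalisation cell (harness21).  Prover seat hodgecm-mathlib-LH4-p04 (g7), req620 Track A «(D-RAM) FOUR-FRAME» squad
(STAGE-1b, heir LEAD F0P3a-plan (g20∕g21) «row T₊ DERIVED»; dealer∕pen LH4-plan (g12∕g13) WORD #48∕#52 «(C2-lev-m_c)»; row-(2) lead LH4-p07 (g8)), 2026-09-04.
-/
import Summits.HodgeConjecture.HodgeConjecture.Theorems.F0P3cDyRamLevelsTypeTwoDictionary          -- ★ p859496 (this seat): (C2-lev-dict) HEAD `finsum_delta_mul_classOrbitalIntegral_levels_eq_of_typeTwo`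
import Summits.HodgeConjecture.HodgeConjecture.Theorems.F0P3cDyRamLevelsCensusClassFunction        -- ★ (this seat): (C2-lev-class) `ncard_typeZero_fixed_levels_eq_of_isConj`
import Summits.HodgeConjecture.HodgeConjecture.Theorems.F0P3cDyRamFixedPointCensusTypeTwoOfOrgansV3  -- ★ p857919 (LH4-p14 (g4)): the unit road's head of organs; brings ★ p857702 `exists_oppositeLiteral_wild`, ★ p847566 frame literal + its κ, ★ p856257 tokens, ★ Prelude
import HarnessLib

/-!
# Crux `H413`, line LH4 «(D-RAM) FOUR-FRAME» — STAGE-1b, row (2): brick (C2-lev-lit) «THE κ-ORBITAL INTEGRAL OF A LEVEL PIECE ON THE TYPE-(2) POPULATION, IN THE TWO LITERAL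
# SHAPES OF SOCKET (C″)» — `Σᶠ_c Δ‴·Φ(c, 𝟙_{K_{a,b}}) = τ·D·νG₃(K)·(cnt_{a,b}(ι_w t_h) − cnt_{a,b}(ι_w t_a))`, `ι_w t_h = endoGL (ι_w γ_H.1, ι_w γ_H.2)`, `ι_w t_a = P₁·endoGL (γ₁, ι_w γ_H.2)·P₁⁻¹`

Cell `hodgecm-mathlib` (D-0151), FLOOR 0, crux item H413 = `stmt-HodgeConjecture-24833`, route of record `HCCMUnconditional`; squad F0∕P3c∕LH4; lane
`--supports stmt-HodgeConjecture-24833 --as helper` (count-neutral; pays NO tier-0 row).  THEOREMS ONLY (no `def`, no instance, no notation, no `sorry`, default heartbeats outside the one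
statement budget).  Consumer: the D-1b `stub_hside_levLo∕levHi` H-triples, row (2) (dealer g13 WORD #52 §3; (V6) ★ p859279's `hG` for `F := 𝟙_{K_{a,b}}`).

THE STEP.  ★ p859496 (C2-lev-dict) reads the κ-orbital integral of `𝟙_{K_{a,b}}` on a `G`-regular type-(2) `γ_H` as `τ·D·νG₃(K)·(cnt_{a,b}(ι_w δ₊) − cnt_{a,b}(ι_w δ₋))` at
abstract matches `δ_±` of κ-signs `±1`, determined up to conjugacy (exhaustion clauses).  The unit road's organs name CONCRETE representatives: the HYPERBOLIC frame literal
`t_h` (★ p847566 `exists_isLocalNormPair_coe_eq_of_frame` in `Φ₃`'s own frame, `κ(t_h) = (1, θ)_v = +1` ★ `finKappaAt_eq_hilbertSymbol_of_coe_eq_of_frame`) with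
`ι_w t_h = endoGL (ι_w γ_H.1, ι_w γ_H.2)`, and the ANISOTROPIC literal `t_a` of ★ p857702 (F0P3a-p01 (g33)) `exists_oppositeLiteral_wild` (`κ(t_a) = −1`, frame
`formCongr σ_w P₁ (Φ₃)_w = block(diag dg, η)`, `η` a non-norm unit, `γ₁ ∈ U(diag dg)` with `χ_{γ₁} = χ_{g_w}`) — the two LITERAL SHAPES of socket (C″) that ★ p859421 ∕ ★ p859485
(this seat) and LH4-p07 (g8)'s row-(2) organs price.  Since `cnt_{a,b} ∘ ι_w` is a class function (★ (C2-lev-class)), the abstract counts ARE the literal counts.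
* HEAD `finsum_delta_mul_classOrbitalIntegral_levels_eq_literals` — near `1` (the neighbourhood of ★ p857702), for every `G`-regular type-(2) `γ_H` and the wild datum
  `(d, t_E)`: `∃ t_h t_a P₁ dg η γ₁` with the socket-(C″) shape clauses, `κ(t_h) = 1`, `κ(t_a) = −1`, and
  `Σᶠ_c Δ‴(γ_H, out c)·Φ(c, 𝟙_{K_{a,b}}; mG₃) = finTau·finWeylRatio·(νG₃(K).toReal·(cnt_{a,b}(ι_w t_h) − cnt_{a,b}(ι_w t_a)))`.
What stays for the producers: the scalar `τ·D = (β, θ)_v·q_v^{−m}` (★ p856257 tokens + ★ Pointwise, piece-free) and THE LAW — the two counts in closed form (order forms ★ p859421 ∕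
p859485 over the eigen-package's line model, tables (T5-P-axis)); nothing of that is asserted here.
HONEST LABEL.  Count-neutral, LAW-FREE; pays no registered stub; `HC_CM` is proved only modulo the 7 printed citations (2 remaining named inputs: hLiu418 =
`stmt-HodgeConjecture-24832`, h413 = `stmt-HodgeConjecture-24833`) until rung 0 closes.
## References
* [Rogawski1990] J. D. Rogawski, *Automorphic Representations of Unitary Groups in Three Variables*, Ann. of Math. Stud. 123 (1990): §4.3 (4.3.1)–(4.3.2) p. 43; §4.9 Prop. 4.9.1 (b) p. 55, Lemma 4.9.3 p. 56.
* [Kottwitz1988] R. E. Kottwitz, *Tamagawa numbers*, Ann. of Math. 127 (1988): §2.  [Kottwitz1986BaseChangeUnits] R. E. Kottwitz, Compositio Math. 60 (1986): §1 pp. 240–241.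
* [Jacobowitz1962] R. Jacobowitz, *Hermitian forms over local fields*, Amer. J. Math. 84 (1962): §7 Thm. 7.1.
-/

set_option autoImplicit false

noncomputable section
namespace Summit.HodgeConjecture.HodgeConjecture.Cruxes.H413.F0P3cDyRamLevelsTypeTwoLiterals

open MeasureTheory Measure NumberField IsDedekindDomain Topology Filter
open Literature.NumberTheory.Automorphic Literature.NumberTheory.Automorphic.UnitaryGroup Literature.NumberTheory.Automorphic.IntegralReduction
open Literature.NumberTheory.Rogawski1990 Literature.NumberTheory.GaloisRepresentations
open Literature.NumberTheory.Automorphic.UnitaryThreeFourFrame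
open Summit.HodgeConjecture.HodgeConjecture.Cruxes.H413.F0P3cDyRamFourFrameHSideDefs
open scoped Matrix MatrixGroups Classical Valued WithZero
open Literature.NumberTheory.Automorphic.UnitaryLatticeTree Literature.NumberTheory.Automorphic.HermitianLattice
open Literature.NumberTheory.QuadraticForms
open Summit.HodgeConjecture.HodgeConjecture.Cruxes.H413.F0P3cDyRamFourFramePieces
open Summit.HodgeConjecture.HodgeConjecture.Cruxes.H413.F0P3cDyRamFourFrameCensusDefs
open Summit.HodgeConjecture.HodgeConjecture.Cruxes.H413.F0P3cDyRamLevelsTypeTwoDictionary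
open Summit.HodgeConjecture.HodgeConjecture.Cruxes.H413.F0P3cDyRamLevelsCensusClassFunction
open Summit.HodgeConjecture.HodgeConjecture.Cruxes.H413

set_option maxHeartbeats 400000 in
-- budget only: statement-heavy tokens (socket (C″)'s literal shapes + the census token twice; default 200000 times out at `whnf` of the statement).
/-- **(C2-lev-lit) THE κ-ORBITAL INTEGRAL OF THE LEVEL PIECE `𝟙_{K_{a,b}}` ON THE TYPE-(2) POPULATION, IN THE TWO LITERAL SHAPES OF SOCKET (C″).**  At a wild ramified non-split
CM place `w ∣ v` (datum `(d, t_E)`), near `1 ∈ H_v`, for every `G`-regular type-(2) `γ_H`: there are a hyperbolic literal `t_h` (`ι_w t_h = endoGL (ι_w γ_H.1, ι_w γ_H.2)`, `κ = +1`)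
and an anisotropic literal `t_a` (`ι_w t_a = P₁·endoGL (γ₁, ι_w γ_H.2)·P₁⁻¹`, frame `block(diag dg, η)`, `η` a non-norm unit, `χ_{γ₁} = χ_{g_w}`, `κ = −1`) with
`Σᶠ_c Δ‴(γ_H, out c)·Φ(c, 𝟙_{K_{a,b}}; mG₃) = finTau·finWeylRatio·(νG₃(K).toReal·(cnt_{a,b}(ι_w t_h) − cnt_{a,b}(ι_w t_a)))`, `cnt_{a,b}` = ★ p858704's token
(★ p859496 at `γ_H`; ★ p847566 + ★ p857702 for the literals; ★ (C2-lev-class) to move the counts onto them).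
[cite: Rogawski1990, §4.3 (4.3.1)–(4.3.2) p. 43; §4.9 Prop. 4.9.1 (b) p. 55, Lemma 4.9.3 p. 56] [cite: Kottwitz1988, §2] [cite: Jacobowitz1962, §7 Thm. 7.1] -/
theorem finsum_delta_mul_classOrbitalIntegral_levels_eq_literals (L : Type) [Field L] [NumberField L] [IsCMField L]
    {v : HeightOneSpectrum (𝓞 ↥(maximalRealSubfield L))} (w : UnitaryGroup.PlacesOver L v)
    (hw : IsCMField.complexConj L • w.1 = w.1) (he : v.asIdeal.ramificationIdx' w.1.asIdeal ≠ 1)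
    (ϖ : (w.1.adicCompletion L)) (hϖ : Valued.v ϖ = WithZero.exp (-1 : ℤ)) (d tE : ℕ)
    (hD : IsRamifiedQuadraticDatum (galAdicCompletionMap (L := L) (IsCMField.complexConj L) hw) ϖ d tE) (μ : HeckeCharacter L)
    [MeasurableSpace ((UnitaryGroup.cmDatum L 3 (Matrix.of fun i j : Fin 3 => if i.val + j.val + 1 = 3 then (1 : L) else 0)).Local v)] [BorelSpace ((UnitaryGroup.cmDatum L 3 (Matrix.of fun i j : Fin 3 => if i.val + j.val + 1 = 3 then (1 : L) else 0)).Local v)]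
    [∀ γ : ((UnitaryGroup.cmDatum L 3 (Matrix.of fun i j : Fin 3 => if i.val + j.val + 1 = 3 then (1 : L) else 0)).Local v), MeasurableSpace (((UnitaryGroup.cmDatum L 3 (Matrix.of fun i j : Fin 3 => if i.val + j.val + 1 = 3 then (1 : L) else 0)).Local v) ⧸ Subgroup.centralizer ({γ} : Set ((UnitaryGroup.cmDatum L 3 (Matrix.of fun i j : Fin 3 => if i.val + j.val + 1 = 3 then (1 : L) else 0)).Local v)))]
    [∀ γ : ((UnitaryGroup.cmDatum L 3 (Matrix.of fun i j : Fin 3 => if i.val + j.val + 1 = 3 then (1 : L) else 0)).Local v), BorelSpace (((UnitaryGroup.cmDatum L 3 (Matrix.of fun i j : Fin 3 => if i.val + j.val + 1 = 3 then (1 : L) else 0)).Local v) ⧸ Subgroup.centralizer ({γ} : Set ((UnitaryGroup.cmDatum L 3 (Matrix.of fun i j : Fin 3 => if i.val + j.val + 1 = 3 then (1 : L) else 0)).Local v)))]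
    (νG₃ : Measure ((UnitaryGroup.cmDatum L 3 (Matrix.of fun i j : Fin 3 => if i.val + j.val + 1 = 3 then (1 : L) else 0)).Local v)) [νG₃.IsHaarMeasure] [νG₃.IsMulRightInvariant]
    (mG₃ : OrbitalMeasureFamily ((UnitaryGroup.cmDatum L 3 (Matrix.of fun i j : Fin 3 => if i.val + j.val + 1 = 3 then (1 : L) else 0)).Local v))
    (hmG : mG₃.IsCanonical (fun γ => IsRegularElt (γ.val : GL (Fin 3) (UnitaryGroup.LocalRing L v))) νG₃) (a b : ℕ) :
    ∃ V ∈ 𝓝 (1 : ((UnitaryGroup.cmDatum L 2 (Matrix.of fun i j : Fin 2 => if i.val + j.val + 1 = 2 then (1 : L) else 0)).Local v × (UnitaryGroup.cmDatum L 1 (Matrix.of fun i j : Fin 1 => if i.val + j.val + 1 = 1 then (1 : L) else 0)).Local v)), ∀ γH ∈ V, IsLocalGRegular L v γH →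
      ¬ (∃ x : (w.1.adicCompletion L), (((((γH).1.val : GL (Fin 2) (UnitaryGroup.LocalRing L v)).val.map (Pi.evalRingHom (fun w' : UnitaryGroup.PlacesOver L v => w'.1.adicCompletion L) w))).charpoly).IsRoot x) →
      ∃ (th ta : ((UnitaryGroup.cmDatum L 3 (Matrix.of fun i j : Fin 3 => if i.val + j.val + 1 = 3 then (1 : L) else 0)).Local v)) (P₁ : GL (Fin 3) (w.1.adicCompletion L)) (dg : Fin 2 → (w.1.adicCompletion L)) (η : (w.1.adicCompletion L)) (γ₁ : GL (Fin 2) (w.1.adicCompletion L)),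
        IsLocalNormPair L (Matrix.of fun i j : Fin 3 => if i.val + j.val + 1 = 3 then (1 : L) else 0) v γH th ∧ finKappaAt L v (Matrix.of fun i j : Fin 3 => if i.val + j.val + 1 = 3 then (1 : L) else 0) γH th = 1 ∧ IsLocalNormPair L (Matrix.of fun i j : Fin 3 => if i.val + j.val + 1 = 3 then (1 : L) else 0) v γH ta ∧ finKappaAt L v (Matrix.of fun i j : Fin 3 => if i.val + j.val + 1 = 3 then (1 : L) else 0) γH ta = -1 ∧
        ((localNonsplitEquiv (IsCMField.complexConj L) (Matrix.of fun i j : Fin 3 => if i.val + j.val + 1 = 3 then (1 : L) else 0) (IsCMField.complexConj_ne_one L) w hw th : ↥(unitaryGroupOfForm (galAdicCompletionMap (L := L) (IsCMField.complexConj L) hw) (placeForm (Matrix.of fun i j : Fin 3 => if i.val + j.val + 1 = 3 then (1 : L) else 0) w.1))) : GL (Fin 3) (w.1.adicCompletion L)) = endoGL (((localNonsplitEquiv (IsCMField.complexConj L) (Matrix.of fun i j : Fin 2 => if i.val + j.val + 1 = 2 then (1 : L) else 0) (IsCMField.complexConj_ne_one L) w hw γH.1 : ↥(unitaryGroupOfForm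 (galAdicCompletionMap (L := L) (IsCMField.complexConj L) hw) (placeForm (Matrix.of fun i j : Fin 2 => if i.val + j.val + 1 = 2 then (1 : L) else 0) w.1))) : GL (Fin 2) (w.1.adicCompletion L)), ((localNonsplitEquiv (IsCMField.complexConj L) (Matrix.of fun i j : Fin 1 => if i.val + j.val + 1 = 1 then (1 : L) else 0) (IsCMField.complexConj_ne_one L) w hw γH.2).val : GL (Fin 1) (w.1.adicCompletion L))) ∧
        ((localNonsplitEquiv (IsCMField.complexConj L) (Matrix.of fun i j : Fin 3 => if i.val + j.val + 1 = 3 then (1 : L) else 0) (IsCMField.complexConj_ne_one L) w hw ta : ↥(unitaryGroupOfForm (galAdicCompletionMap (L := L) (IsCMField.complexConj L) hw) (placeForm (Matrix.of fun i j : Fin 3 => if i.val + j.val + 1 = 3 then (1 : L) else 0) w.1))) : GL (Fin 3) (w.1.adicCompletion L)) = P₁ * endoGL (γ₁, ((localNonsplitEquiv (IsCMField.complexConj L) (Matrix.of fun i j : Fin 1 => if i.val + j.val + 1 = 1 then (1 : L) else 0) (IsCMField.complexConj_ne_one L) w hw γH.2).val : GL (Fin 1) (w.1.adicCompletion L)))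 * P₁⁻¹ ∧
        formCongr (galAdicCompletionMap (L := L) (IsCMField.complexConj L) hw) P₁ (placeForm (Matrix.of fun i j : Fin 3 => if i.val + j.val + 1 = 3 then (1 : L) else 0) w.1) = (!![(Matrix.diagonal dg) 0 0, 0, (Matrix.diagonal dg) 0 1; 0, η, 0; (Matrix.diagonal dg) 1 0, 0, (Matrix.diagonal dg) 1 1] : Matrix (Fin 3) (Fin 3) (w.1.adicCompletion L)) ∧
        (∀ i, Valued.v (dg i) = 1) ∧ (∀ i, (galAdicCompletionMap (L := L) (IsCMField.complexConj L) hw) (dg i) = dg i) ∧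
        (galAdicCompletionMap (L := L) (IsCMField.complexConj L) hw) η = η ∧ Valued.v η = 1 ∧ (¬ ∃ t : (w.1.adicCompletion L), t * (galAdicCompletionMap (L := L) (IsCMField.complexConj L) hw) t = η) ∧
        γ₁ ∈ unitaryGroupOfForm (galAdicCompletionMap (L := L) (IsCMField.complexConj L) hw) (Matrix.diagonal dg) ∧
        (γ₁ : Matrix (Fin 2) (Fin 2) (w.1.adicCompletion L)).charpoly = ((((γH).1.val : GL (Fin 2) (UnitaryGroup.LocalRing L v)).val.map (Pi.evalRingHom (fun w' : UnitaryGroup.PlacesOver L v => w'.1.adicCompletion L) w))).charpoly ∧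
        ∑ᶠ c : ConjClasses ((UnitaryGroup.cmDatum L 3 (Matrix.of fun i j : Fin 3 => if i.val + j.val + 1 = 3 then (1 : L) else 0)).Local v), ((finExplicitCollection L (Matrix.of fun i j : Fin 3 => if i.val + j.val + 1 = 3 then (1 : L) else 0) μ (finExplicitDelta_conj_left_all L (Matrix.of fun i j : Fin 3 => if i.val + j.val + 1 = 3 then (1 : L) else 0) μ) (finExplicitDelta_conj_right_all L (Matrix.of fun i j : Fin 3 => if i.val + j.val + 1 = 3 then (1 : L) else 0) μ)) v).Δ γH (Quotient.out c) * classOrbitalIntegral mG₃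
            (Set.indicator {u : ((UnitaryGroup.cmDatum L 3 (Matrix.of fun i j : Fin 3 => if i.val + j.val + 1 = 3 then (1 : L) else 0)).Local v) |
              u ∈ cmLocalIntegralLevel L 3 (Matrix.of fun i j : Fin 3 => if i.val + j.val + 1 = 3 then (1 : L) else 0) v ∧
              (InLevel ϖ a (wMatrix L w hw u - 1) ∧ InLevel ϖ b ((wMatrix L w hw u - 1) * (wMatrix L w hw u - 1)))} (fun _ => (1 : ℂ))) c =
          finTau L v γH μ * (finWeylRatio L v γH : ℂ) * (((νG₃ ((cmLocalIntegralLevel L 3 (Matrix.of fun i j : Fin 3 => if i.val + j.val + 1 = 3 then (1 : L) else 0) v) : Set ((UnitaryGroup.cmDatum L 3 (Matrix.of fun i j : Fin 3 => if i.val + j.val + 1 = 3 then (1 : L) else 0)).Local v))).toReal : ℂ) *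
            (({M : Submodule (Valued.integer (w.1.adicCompletion L)) (Fin 3 → w.1.adicCompletion L) |
              IsVertexLattice (galAdicCompletionMap (L := L) (IsCMField.complexConj L) hw) ϖ ((StdForm.antidiagonal 3).over (w.1.adicCompletion L)) 0 M ∧
                mapGL ((localNonsplitEquiv (IsCMField.complexConj L) (Matrix.of fun i j : Fin 3 => if i.val + j.val + 1 = 3 then (1 : L) else 0) (IsCMField.complexConj_ne_one L) w hw th : ↥(unitaryGroupOfForm (galAdicCompletionMap (L := L) (IsCMField.complexConj L) hw) (placeForm (Matrix.of fun i j : Fin 3 => if i.val + j.val + 1 = 3 then (1 : L) else 0) w.1))) : GL (Fin 3) (w.1.adicCompletion L)) M = M ∧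
                (LatticeInLevel ϖ a ((((localNonsplitEquiv (IsCMField.complexConj L) (Matrix.of fun i j : Fin 3 => if i.val + j.val + 1 = 3 then (1 : L) else 0) (IsCMField.complexConj_ne_one L) w hw th : ↥(unitaryGroupOfForm (galAdicCompletionMap (L := L) (IsCMField.complexConj L) hw) (placeForm (Matrix.of fun i j : Fin 3 => if i.val + j.val + 1 = 3 then (1 : L) else 0) w.1))) : GL (Fin 3) (w.1.adicCompletion L)) : Matrix (Fin 3) (Fin 3) (w.1.adicCompletion L)) - 1) M ∧
                  LatticeInLevel ϖ b (((((localNonsplitEquiv (IsCMField.complexConj L) (Matrix.of fun i j : Fin 3 => if i.val + j.val + 1 = 3 then (1 : L) else 0) (IsCMField.complexConj_ne_one L) w hw th : ↥(unitaryGroupOfForm (galAdicCompletionMap (L := L) (IsCMField.complexConj L) hw) (placeForm (Matrix.of fun i j : Fin 3 => if i.val + j.val + 1 = 3 then (1 : L) else 0) w.1))) : GL (Fin 3) (w.1.adicCompletion L)) : Matrix (Fin 3) (Fin 3) (w.1.adicCompletion L)) - 1) *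
                    ((((localNonsplitEquiv (IsCMField.complexConj L) (Matrix.of fun i j : Fin 3 => if i.val + j.val + 1 = 3 then (1 : L) else 0) (IsCMField.complexConj_ne_one L) w hw th : ↥(unitaryGroupOfForm (galAdicCompletionMap (L := L) (IsCMField.complexConj L) hw) (placeForm (Matrix.of fun i j : Fin 3 => if i.val + j.val + 1 = 3 then (1 : L) else 0) w.1))) : GL (Fin 3) (w.1.adicCompletion L)) : Matrix (Fin 3) (Fin 3) (w.1.adicCompletion L)) - 1)) M)}.ncard : ℂ) -
             ({M : Submodule (Valued.integer (w.1.adicCompletion L)) (Fin 3 → w.1.adicCompletion L) |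
              IsVertexLattice (galAdicCompletionMap (L := L) (IsCMField.complexConj L) hw) ϖ ((StdForm.antidiagonal 3).over (w.1.adicCompletion L)) 0 M ∧
                mapGL ((localNonsplitEquiv (IsCMField.complexConj L) (Matrix.of fun i j : Fin 3 => if i.val + j.val + 1 = 3 then (1 : L) else 0) (IsCMField.complexConj_ne_one L) w hw ta : ↥(unitaryGroupOfForm (galAdicCompletionMap (L := L) (IsCMField.complexConj L) hw) (placeForm (Matrix.of fun i j : Fin 3 => if i.val + j.val + 1 = 3 then (1 : L) else 0) w.1))) : GL (Fin 3) (w.1.adicCompletion L)) M = M ∧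
                (LatticeInLevel ϖ a ((((localNonsplitEquiv (IsCMField.complexConj L) (Matrix.of fun i j : Fin 3 => if i.val + j.val + 1 = 3 then (1 : L) else 0) (IsCMField.complexConj_ne_one L) w hw ta : ↥(unitaryGroupOfForm (galAdicCompletionMap (L := L) (IsCMField.complexConj L) hw) (placeForm (Matrix.of fun i j : Fin 3 => if i.val + j.val + 1 = 3 then (1 : L) else 0) w.1))) : GL (Fin 3) (w.1.adicCompletion L)) : Matrix (Fin 3) (Fin 3) (w.1.adicCompletion L)) - 1) M ∧
                  LatticeInLevel ϖ b (((((localNonsplitEquiv (IsCMField.complexConj L) (Matrix.of fun i j : Fin 3 => if i.val + j.val + 1 = 3 then (1 : L) else 0) (IsCMField.complexConj_ne_one L) w hw ta : ↥(unitaryGroupOfForm (galAdicCompletionMap (L := L) (IsCMField.complexConj L) hw) (placeForm (Matrix.of fun i j : Fin 3 => if i.val + j.val + 1 = 3 then (1 : L) else 0) w.1))) : GL (Fin 3) (w.1.adicCompletion L)) : Matrix (Fin 3) (Fin 3) (w.1.adicCompletion L)) - 1) *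
                    ((((localNonsplitEquiv (IsCMField.complexConj L) (Matrix.of fun i j : Fin 3 => if i.val + j.val + 1 = 3 then (1 : L) else 0) (IsCMField.complexConj_ne_one L) w hw ta : ↥(unitaryGroupOfForm (galAdicCompletionMap (L := L) (IsCMField.complexConj L) hw) (placeForm (Matrix.of fun i j : Fin 3 => if i.val + j.val + 1 = 3 then (1 : L) else 0) w.1))) : GL (Fin 3) (w.1.adicCompletion L)) : Matrix (Fin 3) (Fin 3) (w.1.adicCompletion L)) - 1)) M)}.ncard : ℂ))) := by
  classical
  obtain ⟨VA, hVA, hA⟩ := F0P3cDyRamTypeTwoOppositeLiteralWild.exists_oppositeLiteral_wild L w hw he hD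
  refine ⟨VA, hVA, fun γH hγA hreg hirr => ?_⟩
  -- (C2-lev-dict) at `γ_H`: abstract matches `δ_±`, exhaustion, and the census difference
  obtain ⟨δp, δm, hp, hκp, hm, hκm, hexp, hexm, hsum⟩ :=
    finsum_delta_mul_classOrbitalIntegral_levels_eq_of_typeTwo L w hw he ϖ hϖ μ νG₃ mG₃ hmG a b hreg hirr
  -- THE HYPERBOLIC LITERAL `t_h` (★ frame literal in `Φ₃`'s own frame `A := 1`; `κ = (1, θ)_v = 1`)
  have hu : IsUnit ((finCharpolyTwo L v γH).eval (finGammaTwo L v γH)) := isUnit_eval_finCharpolyTwo_of_isLocalGRegular L v γH hreg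
  have hH'w : IsUnit (placeForm (Matrix.of fun i j : Fin 3 => if i.val + j.val + 1 = 3 then (1 : L) else 0) w.1) := isUnit_placeForm_antidiagOne (E := L) 3 w.1
  have hdet : (placeForm (Matrix.of fun i j : Fin 3 => if i.val + j.val + 1 = 3 then (1 : L) else 0) w.1).det = -1 := by
    rw [placeForm_antidiagOne, F0P3cDyRamFixedPointCensusTypeTwoPrelude.antidiagonal_three_over_eq_block_antidiagonal_two, Matrix.det_fin_three]
    simp [StdForm.over, StdForm.antidiagonal_J_apply, Fin.rev]
  have hframe : placeForm (Matrix.of fun i j : Fin 3 => if i.val + j.val + 1 = 3 then (1 : L) else 0) w.1 = (-(placeForm (Matrix.of fun i j : Fin 3 => if i.val + j.val + 1 = 3 then (1 : L) else 0) w.1).det) •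
      formCongr (galAdicCompletionMap (L := L) (IsCMField.complexConj L) hw) (1 : GL (Fin 3) (w.1.adicCompletion L)) ((StdForm.antidiagonal 3).over (w.1.adicCompletion L)) := by
    rw [formCongr_one_eq, hdet, neg_neg, one_smul, placeForm_antidiagOne]
  have hyl : toPlace v w (1 : (v.adicCompletion ↥(maximalRealSubfield L))) = -(placeForm (Matrix.of fun i j : Fin 3 => if i.val + j.val + 1 = 3 then (1 : L) else 0) w.1).det := by rw [map_one, hdet, neg_neg]
  obtain ⟨th, hth, hmat⟩ := exists_isLocalNormPair_coe_eq_of_frame L (Matrix.of fun i j : Fin 3 => if i.val + j.val + 1 = 3 then (1 : L) else 0) w hw hH'w 1 hframe γH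
  have hκh : finKappaAt L v (Matrix.of fun i j : Fin 3 => if i.val + j.val + 1 = 3 then (1 : L) else 0) γH th = 1 := by
    rw [finKappaAt_eq_hilbertSymbol_of_coe_eq_of_frame L (Matrix.of fun i j : Fin 3 => if i.val + j.val + 1 = 3 then (1 : L) else 0) w hw hH'w 1 hframe 1 hyl γH hu hth hmat, hilbertSymbol_one_left]
  rw [inv_one, one_mul, mul_one] at hmat
  -- THE ANISOTROPIC LITERAL `t_a` (★ p857702)
  obtain ⟨ta, P₁, dg, η, γ₁, hta, hκa, hA1, hA2, hA3, hA4, hA7, hA8, hA9, hA10, hA12⟩ := hA γH hγA hreg hirr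
  -- move the two counts onto the literals (★ (C2-lev-class))
  rw [← ncard_typeZero_fixed_levels_eq_of_isConj L w hw ϖ a b (hexp th hth hκh),
    ← ncard_typeZero_fixed_levels_eq_of_isConj L w hw ϖ a b (hexm ta hta hκa)] at hsum
  exact ⟨th, ta, P₁, dg, η, γ₁, hth, hκh, hta, hκa, hmat, hA1, hA2, hA3, hA4, hA7, hA8, hA9, hA10, hA12, hsum⟩

end Summit.HodgeConjecture.HodgeConjecture.Cruxes.H413.F0P3cDyRamLevelsTypeTwoLiterals

end
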